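import Summits.BirchSwinnertonDyer.BirchSwinnertonDyer.Theorems.GenusKolyvaginAtTwoMinimalTwinBSDTwoSwappedPairSilentPrime
import Summits.BirchSwinnertonDyer.BirchSwinnertonDyer.Theorems.GenusKolyvaginAtTwoMinimalTwinBSDTwoSwappedPairFrame
import Summits.BirchSwinnertonDyer.BirchSwinnertonDyer.Theorems.GenusKolyvaginAtTwoGenusPrimitiveSupplyAtTwoPrimeHeegnerTwinPosDisc
import Summits.BirchSwinnertonDyer.BirchSwinnertonDyer.Theorems.GenusKolyvaginAtTwoGenusPrimitiveSupplyAtTwoSupplyDEF1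
import Summits.BirchSwinnertonDyer.BirchSwinnertonDyer.Theorems.GenusKolyvaginAtTwoGenusPrimitiveSupplyAtTwoArchimedeanRowsHold
import Summits.BirchSwinnertonDyer.BirchSwinnertonDyer.Theorems.GenusKolyvaginAtTwoGenusPrimitiveSupplyAtTwoArchimedeanUnramifiedRowsHold
import Literature.NumberTheory.EllipticCurves.ModularityVersionApProofs
import HarnessLib

/-!
# Route `GenusKolyvaginAtTwo`, crux U₂ `MinimalTwinBSDTwo` (stmt-BirchSwinnertonDyer-22985): THE `Δ > 0` CELL SPLITS BY THE EGG —
# a reversed ALL-SILENT `2`-Selmer-trivial Heegner twin exists ONLY for curves meeting the egg (`E(ℚ) ⊄ E⁰(ℝ)`), and then its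
# Selmer clause is AUTOMATIC; LINE 23's S2″ (and this seat's prime-frame S2″′) as typed force every `Δ > 0` habitat curve onto the egg

Seat `bsd-line-gk2-p3` g28 (PROVER seat 3/3, cell `bsd-f1-sign2`), `--supports stmt-BirchSwinnertonDyer-22985` (helper; closes nothing).
THEOREMS ONLY (no definition, no named fact, no `sorry`); standard axioms.  **BSD is NOT proved by this file; U₂ is NOT proved; no item is
closed.**  §1–§3 are UNCONDITIONAL (the cell's Kramer / Mazur–Rubin rows `GenusKolyArch.eggTwistLawAtTwo_holds`, `…_unram` — Poitou–Tate,
Tate's χ and Kramer's congruence are tree theorems — composed with this seat's silent budget and gk2's bridges `GenusKolyTwin.descAdmissible*_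
discr_of_forall_silent`); §4 is CONDITIONAL only on GZK (`rank_eq_analyticRank_of_analyticRank_le_one`, item 19921) to turn `r_an = 1` into
rank `1`, and DISPLAYS the supply texts S2″ / S2″′ as hypotheses in order to draw their consequence.

THE MECHANISM (Kramer 1981 Prop. 6 / Mazur–Rubin 2010 Cor. 3.4 (i) with `T = {∞}`).  Let `W/ℚ` be globally minimal with `Δ_W > 0`,
`ρ̄_{W,2}` onto, rank `1`, `#Sel₂(W) = 2` (so `W(ℚ)[2] = 0`, `Ш(W)[2] = 0`), and let `K` be imaginary quadratic with `d_K` odd, Heegner for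
`N_W`, and `Wd = Cd • W^(d_K)` with the twist SILENT (`ord₂ C(Wd) = ord₂ C(W)`, i.e. every prime of `d_K` sees no root of the `2`-division
cubic — this seat's `Silent.prod_ncard_roots_add_one_eq_one_of_padicValNat_eq`).  Then `d_K` is `-desc`-admissible (`≡ 1 (8)`) or
unramified-admissible (`≡ 5 (8)`, `W` good at `2` because a Heegner field with `2 ∣ N_W` has `2` split), the local Kummer conditions of `W`
and `Wd` agree at EVERY finite place, and differ transversally at `∞`; so `#Sel₂(Wd) = #Sel₂(W)/2 = 1` if some Selmer class of `W` is
non-trivial at `∞` — iff `W(ℚ)` MEETS THE EGG — and `#Sel₂(Wd) = 2·#Sel₂(W) = 4` if `W(ℚ) ⊂ W⁰(ℝ)`.  INDEPENDENTLY OF `K`.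

* §1 helpers: `shaTwoTrivial_of_natCard_selmerGroup_eq_two` (`#Sel₂ = 2`, rank `≥ 1` ⟹ `Ш(W)[2] = 0`, from g23's
  `rank_eq_one_and_sha_primary_eq_zero_of_natCard_selmerGroup_eq_two`); `forall_noRoot_of_padicValNat_eq` (silent ⟹ every prime of `d_K` rootless).
* §2 **`natCard_selmerGroup_twin_of_silent`** — the dichotomy: `(MeetsEgg W → #Sel₂(Wd) = 1) ∧ (¬ MeetsEgg W → #Sel₂(Wd) = 4)` for EVERY
  silent odd Heegner frame (UNCONDITIONAL).
* §3 **`meetsEgg_of_silent_selmerTrivial_twin`** — a silent Heegner twin with `#Sel₂(Wd) = 1` exists only if `W` meets the egg;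
  **`natCard_selmerGroup_twin_eq_one_of_meetsEgg_of_silent`** — and if `W` meets the egg EVERY silent odd Heegner twin has `#Sel₂(Wd) = 1`.
* §4 CONSEQUENCES FOR THE LEDGER (mod GZK): **`meetsEgg_of_reversedMinimalSupplyAtTwoExponent_of_facts`** — LINE 23 v1.3's S2″
  (`ReversedMinimalSupplyAtTwoExponent`, binder text verbatim) implies: every non-CM globally minimal `W` with `r_an = 1`, `#Sel₂ = 2`,
  `C(W)` odd, `ρ̄_{W,2}` onto and `Δ_W > 0` MEETS THE EGG; **`meetsEgg_of_reversedSupplyExponentPrime_of_facts`** — the same for this seat's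
  prime-frame S2″′ (`…RouteLedgerLine25Prime`, binder `hS2ep` verbatim).  So S2″ / S2″′ AS TYPED are false as soon as ONE such curve with
  `W(ℚ) ⊂ W⁰(ℝ)` exists (descent sign `ε = −1`; the sibling route's census — `Cruxes/RankOneAtTwoBigImageOddLocal/Lines/egg_kolyvagin_two.lean`
  v6, kit j298065 — counts 5 293 rank-one `ε = −1` curves with `N < 6·10⁴`; the cell's T-C census 65 of 440); a kernel refutation would need
  the analytic rank of one such curve, which is not certifiable here.  READING (planner currency): the cell `hTw0 = (Δ>0, ord₂ C = 0)` of U₂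
  SPLITS as `hTw0^{egg} ⊔ hTw0^{id}`; on `hTw0^{egg}` the reversed all-silent supply needs NO Selmer clause (§3, automatic), on `hTw0^{id}`
  NO all-silent reversed supply exists — the twin there must carry two transposition primes (`ord₂ C(Wd) = ord₂ C(W) + 2`, the sibling
  line's «two finite doors» T-2q / AN-26), i.e. `hTw0^{id}` is the U₂-side image of the `K₄⁺` / X⁼²-type cells.  `closes` DOES hand U₂
  identity-type twins (those of the wide-Selmer habitat curves `#Sel₂(E) = 4` with a real-non-trivial class: T-V / `strictShaPropagationAtTwo`),
  so LINE 23 covers `hTw0^{egg}` only.  The same dichotomy governs `hTw2 = (Δ>0, ord₂ C = 2)` (§2 is blind to `C(W)`).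

References: [Kramer1981] §2 Props. 3, 6, Thm. 1; [MazurRubin2010] Thm. 2.7, Lemmas 2.9–2.11, Prop. 3.3, Cor. 3.4 (i); [Mazur1972] Cor. 4.4;
[BrumerKramer1977] Prop. 3.7; [GrossLMS1991] §1; [SilvermanAEC2009] Ex. III.3.7, X.4.2; [Miller2011LMS] Def. 1.1.
-/

set_option autoImplicit false
set_option linter.dupNamespace false -- `Summit.<P>.<Sub>` repeats `BirchSwinnertonDyer` (D-0017)

noncomputable section

open scoped Classical

open WeierstrassCurve NumberField Literature.NumberTheory.EllipticCurves Literature.NumberTheory.QuadraticFields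
  Literature.NumberTheory.EllipticCurves.ModularForms
  Summit.BirchSwinnertonDyer.Rank1Residual.F1Sign2
  Summit.BirchSwinnertonDyer.BirchSwinnertonDyer.Theorems.GenusExact.TwinSwap
  Summit.BirchSwinnertonDyer.BirchSwinnertonDyer.Theorems.GenusExact.TwinSwap.Silent

namespace Summit.BirchSwinnertonDyer.BirchSwinnertonDyer.Theorems.GenusExact.TwinSwap.Egg

/-! ## §1 Helpers: `Ш(W)[2] = 0` on U₂'s habitat; silent ⟹ every prime of `d_K` is rootless -/

/-- **`#Sel₂(W) = 2` and rank `≥ 1` ⟹ `Ш(W)[2] = 0`** in the cell's currency `F1Sign2.ShaTwoTrivial` (from g23's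
`rank_eq_one_and_sha_primary_eq_zero_of_natCard_selmerGroup_eq_two`: the `2`-primary part of `Ш(W)` vanishes).  UNCONDITIONAL.
[cite: SilvermanAEC2009, X.4.2] -/
theorem shaTwoTrivial_of_natCard_selmerGroup_eq_two (W : WeierstrassCurve ℚ) [W.IsElliptic]
    (hSel : Nat.card (W.selmerGroup 2) = 2) (hrk : 1 ≤ W.mordellWeilRank) : ShaTwoTrivial W := by
  haveI : Fact (Nat.Prime 2) := ⟨Nat.prime_two⟩
  obtain ⟨-, -, hsha⟩ := rank_eq_one_and_sha_primary_eq_zero_of_natCard_selmerGroup_eq_two W hSel hrk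
  intro c hc h2
  have hmem : (⟨c, hc⟩ : ↥W.sha) ∈ AddCommGroup.primaryComponent (↥W.sha) 2 := by
    rw [AddCommGroup.mem_primaryComponent]
    refine ⟨1, ?_⟩
    rw [pow_one]
    exact Subtype.ext (by simpa using h2)
  have h0 := hsha _ hmem
  exact congrArg Subtype.val h0

/-- **Silent ⟹ rootless at every prime of `d_K`**: if `ord₂ C(Wd) = ord₂ C(W)` for an elliptic model `Wd` of `W^(d_K)` (`K` imaginary
quadratic, `d_K` odd, Heegner for `N_W`), then the `2`-division cubic of the minimal model of `W` has no root modulo every prime of `d_K`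
(this seat's hT-free budget `∏_q (n_q + 1) = 2^{ord₂ C(Wd) − ord₂ C(W)} = 1`).  UNCONDITIONAL.  [cite: Kramer1981, §2 Prop. 3] -/
theorem forall_noRoot_of_padicValNat_eq (W : WeierstrassCurve ℚ) [W.IsElliptic] [W.IsGloballyMinimal]
    {K : Type} [Field K] [NumberField K] (hK : IsImaginaryQuadratic K) (hodd : Odd (discr K))
    (hH : SatisfiesHeegnerHypothesis (W.conductorNorm ℤ) K)
    {Wd : WeierstrassCurve ℚ} [Wd.IsElliptic] (Cd : VariableChange ℚ) (hWd : Cd • W.quadraticTwist (discr K : ℚ) = Wd)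
    (hSil : padicValNat 2 Wd.tamagawaProduct = padicValNat 2 W.tamagawaProduct) :
    ∀ (q : ℕ) [Fact q.Prime], (q : ℤ) ∣ discr K → ∀ x : ZMod q,
      4 * x ^ 3 + ((integralModelInt W).b₂ : ZMod q) * x ^ 2 + 2 * ((integralModelInt W).b₄ : ZMod q) * x +
        ((integralModelInt W).b₆ : ZMod q) ≠ 0 := by
  intro q _ hqd
  have hprod := prod_ncard_roots_add_one_eq_one_of_padicValNat_eq W hK hodd hH Cd hWd hSil
  have hq : q.Prime := Fact.out
  have hmem : q ∈ (discr K).natAbs.primeFactors :=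
    Nat.mem_primeFactors.mpr ⟨hq, Int.natCast_dvd.mp hqd, Int.natAbs_ne_zero.mpr (NumberField.discr_ne_zero K)⟩
  rw [← Finset.mul_prod_erase _ _ hmem] at hprod
  have h1 := Nat.eq_one_of_mul_eq_one_right hprod
  intro x hx
  have h0 : {x : ZMod q | 4 * x ^ 3 + ((integralModelInt W).b₂ : ZMod q) * x ^ 2 +
      2 * ((integralModelInt W).b₄ : ZMod q) * x + ((integralModelInt W).b₆ : ZMod q) = 0}.ncard = 0 := by omega
  rw [Set.ncard_eq_zero (Set.toFinite _)] at h0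
  exact (Set.eq_empty_iff_forall_notMem.mp h0) x hx

/-! ## §2 The dichotomy: the `2`-Selmer group of a silent Heegner twin is decided by the egg -/

/-- **THE EGG DECIDES THE SILENT TWIN.**  `W/ℚ` globally minimal elliptic with `Δ_W > 0`, `ρ̄_{W,2}` onto, rank `1`, `#Sel₂(W) = 2`; `K`
imaginary quadratic, `d_K` odd, Heegner for `N_W`; `Wd = Cd • W^(d_K)` elliptic and SILENT (`ord₂ C(Wd) = ord₂ C(W)`).  Then
**`#Sel₂(Wd) = 1` if `W(ℚ)` meets the egg, and `#Sel₂(Wd) = 4` if `W(ℚ) ⊂ W⁰(ℝ)`** — whatever `K`.  The cell's unconditional rows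
(`GenusKolyArch.eggTwistLawAtTwo_holds` for `d_K ≡ 1 (8)`; `…_unram` rows for `d_K ≡ 5 (8)`, where `2 ∤ N_W` because a Heegner prime
`2 ∣ N_W` would split) on the frame made admissible by §1 and gk2's bridges.  UNCONDITIONAL.
[cite: Kramer1981, §2 Props. 3, 6, Thm. 1] [cite: MazurRubin2010, Thm. 2.7, Cor. 3.4 (i)] [cite: Mazur1972, Cor. 4.4] -/
theorem natCard_selmerGroup_twin_of_silent (W : WeierstrassCurve ℚ) [W.IsElliptic] [W.IsGloballyMinimal]
    {K : Type} [Field K] [NumberField K] (hK : IsImaginaryQuadratic K) (hodd : Odd (discr K))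
    (hH : SatisfiesHeegnerHypothesis (W.conductorNorm ℤ) K)
    (hΔ : 0 < W.Δ) (hsurj : W.HasSurjectiveModNGaloisRep 2) (hrk : W.mordellWeilRank = 1) (hSel : Nat.card (W.selmerGroup 2) = 2)
    {Wd : WeierstrassCurve ℚ} [Wd.IsElliptic] (Cd : VariableChange ℚ) (hWd : Cd • W.quadraticTwist (discr K : ℚ) = Wd)
    (hSil : padicValNat 2 Wd.tamagawaProduct = padicValNat 2 W.tamagawaProduct) :
    (MeetsEgg W → Nat.card (Wd.selmerGroup 2) = 1) ∧ (¬ MeetsEgg W → Nat.card (Wd.selmerGroup 2) = 4) := by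
  have hT : NoRationalTwoTorsion W := GenusKolyTwin.noRationalTwoTorsion_of_hasSurjectiveModNGaloisRep W (by simpa using hsurj)
  have hSha : ShaTwoTrivial W := shaTwoTrivial_of_natCard_selmerGroup_eq_two W hSel (le_of_eq hrk.symm)
  have hsilent := forall_noRoot_of_padicValNat_eq W hK hodd hH Cd hWd hSil
  have hmodel : Nat.card (Wd.selmerGroup 2) = twistSelmerTwoCard W (discr K) :=
    GenusKolyTwin.natCard_selmerGroup_model_eq_twistSelmerTwoCard W (NumberField.discr_ne_zero K) Wd ⟨Cd, hWd⟩
  have hS2 : selmerTwoCard W = 2 := by unfold selmerTwoCard; exact hSel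
  have h4 : discr K % 4 = 1 := Quadratic.discr_emod_four_eq_one hK.1 hodd
  rw [hmodel]
  by_cases h8 : discr K % 8 = 1
  · -- `2` split: `-desc`-admissible frame, the Egg Twist Law verbatim
    have h2K := (Quadratic.ncard_primesOver_two_eq_two_iff hK.1).mpr h8
    have hDA : DescAdmissible W (discr K) := GenusKolyTwin.descAdmissible_discr_of_forall_silent W hK hodd hH h2K hsilent
    exact GenusKolyArch.eggTwistLawAtTwo_holds W hΔ hT hrk hSha (discr K) hDA
  · -- `2` inert: `d_K ≡ 5 (8)`, and `2 ∤ N_W` (else `2` would split), so `W` is good at `2`: the unramified rows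
    have h5 : discr K % 8 = 5 := by omega
    have h2N : ¬ 2 ∣ W.conductorNorm ℤ := fun h2N ↦
      h8 ((Quadratic.ncard_primesOver_two_eq_two_iff hK.1).mp (hH 2 Nat.prime_two h2N))
    have hgood2 : ∀ _h : Fact (Nat.Prime 2), W.HasGoodReductionAtPrime 2 := fun _ ↦ by
      by_contra hbad
      exact h2N ((W.dvd_conductorNorm_iff_not_hasGoodReductionAtPrime 2).mpr hbad)
    have hDAU : DescAdmissibleUnram W (discr K) :=
      GenusKolyTwin.descAdmissibleUnram_discr_of_forall_silent W hK hodd hH h5 hgood2 hsilent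
    constructor
    · intro hegg
      have hns := (GenusKolyArch.meetsEgg_iff_exists_localization_inl_ne_zero W hΔ hT hSha).mp hegg
      have h := GenusKolyArch.two_mul_twistSelmerTwoCard_eq_of_exists_unram W hΔ hns hDAU
      omega
    · intro hegg
      have hstrict := GenusKolyArch.forall_mem_selmerGroup_localization_inl_eq_zero_of_not_meetsEgg W hΔ hT hSha hegg
      have h := GenusKolyArch.twistSelmerTwoCard_eq_two_mul_of_strict_unram W hΔ hstrict hDAU
      omega

/-! ## §3 Corollaries: existence ⟺ the egg -/

/-- **A silent `2`-Selmer-trivial Heegner twin exists ONLY on the egg locus**: under the frame of §2, `#Sel₂(Wd) = 1 ⟹ MeetsEgg W`.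
UNCONDITIONAL.  [cite: Kramer1981, §2 Prop. 6] [cite: MazurRubin2010, Cor. 3.4 (i)] -/
theorem meetsEgg_of_silent_selmerTrivial_twin (W : WeierstrassCurve ℚ) [W.IsElliptic] [W.IsGloballyMinimal]
    {K : Type} [Field K] [NumberField K] (hK : IsImaginaryQuadratic K) (hodd : Odd (discr K))
    (hH : SatisfiesHeegnerHypothesis (W.conductorNorm ℤ) K)
    (hΔ : 0 < W.Δ) (hsurj : W.HasSurjectiveModNGaloisRep 2) (hrk : W.mordellWeilRank = 1) (hSel : Nat.card (W.selmerGroup 2) = 2)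
    {Wd : WeierstrassCurve ℚ} [Wd.IsElliptic] (Cd : VariableChange ℚ) (hWd : Cd • W.quadraticTwist (discr K : ℚ) = Wd)
    (hSil : padicValNat 2 Wd.tamagawaProduct = padicValNat 2 W.tamagawaProduct) (hSel1 : Nat.card (Wd.selmerGroup 2) = 1) :
    MeetsEgg W := by
  by_contra hegg
  have h4 := (natCard_selmerGroup_twin_of_silent W hK hodd hH hΔ hsurj hrk hSel Cd hWd hSil).2 hegg
  omega

/-- **On the egg locus EVERY silent odd Heegner twin is `2`-Selmer-trivial**: under the frame of §2, `MeetsEgg W ⟹ #Sel₂(Wd) = 1` — the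
Selmer clause of the reversed all-silent supplies S2″ / S2″′ / S2⁼′ is automatic there.  UNCONDITIONAL.
[cite: Kramer1981, §2 Prop. 6] [cite: MazurRubin2010, Cor. 3.4 (i)] -/
theorem natCard_selmerGroup_twin_eq_one_of_meetsEgg_of_silent (W : WeierstrassCurve ℚ) [W.IsElliptic] [W.IsGloballyMinimal]
    {K : Type} [Field K] [NumberField K] (hK : IsImaginaryQuadratic K) (hodd : Odd (discr K))
    (hH : SatisfiesHeegnerHypothesis (W.conductorNorm ℤ) K)
    (hΔ : 0 < W.Δ) (hsurj : W.HasSurjectiveModNGaloisRep 2) (hrk : W.mordellWeilRank = 1) (hSel : Nat.card (W.selmerGroup 2) = 2)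
    {Wd : WeierstrassCurve ℚ} [Wd.IsElliptic] (Cd : VariableChange ℚ) (hWd : Cd • W.quadraticTwist (discr K : ℚ) = Wd)
    (hSil : padicValNat 2 Wd.tamagawaProduct = padicValNat 2 W.tamagawaProduct) (hegg : MeetsEgg W) :
    Nat.card (Wd.selmerGroup 2) = 1 :=
  (natCard_selmerGroup_twin_of_silent W hK hodd hH hΔ hsurj hrk hSel Cd hWd hSil).1 hegg

/-! ## §4 Consequences for LINE 23's reversed supplies S2″ and S2″′ (mod GZK) -/

/-- **LINE 23 v1.3's S2″ forces every `Δ > 0` habitat curve onto the egg** (mod GZK).  With `hS2e` = `ReversedMinimalSupplyAtTwoExponent`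
(binder text verbatim, as in this seat's ledgers): for every non-CM globally minimal `W` with `r_an(W) = 1`, `#Sel₂(W) = 2`, `C(W)` odd,
`ρ̄_{W,2}` onto and `Δ_W > 0`, **`W(ℚ)` meets the egg**.  (S2″'s twin on `Δ > 0` has `ord₂ C(Wd) = 0 = ord₂ C(W)`: silent; then §3.)
Hence S2″ AS TYPED is contradicted by any such curve with `W(ℚ) ⊂ W⁰(ℝ)` (descent sign `ε = −1`).  CONDITIONAL on the displayed
hypotheses; proves nothing about BSD; closes nothing.  [cite: Kramer1981, §2 Prop. 6] [cite: MazurRubin2010, Cor. 3.4 (i)]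
[cite: Kolyvagin1989Izv, Thm. A] -/
theorem meetsEgg_of_reversedMinimalSupplyAtTwoExponent_of_facts (hGZK : rank_eq_analyticRank_of_analyticRank_le_one)
    (hS2e : ∀ (W : WeierstrassCurve ℚ) [W.IsElliptic] [W.IsGloballyMinimal] [NeZero (W.conductorNorm ℤ)],
      ¬ W.HasCM → W.analyticRank = 1 → Nat.card (W.selmerGroup 2) = 2 → Odd W.tamagawaProduct →
      ∃ (K : Type) (_ : Field K) (_ : NumberField K),
        IsImaginaryQuadratic K ∧ Odd (NumberField.discr K) ∧ NumberField.discr K ≠ -3 ∧ SatisfiesHeegnerHypothesis (W.conductorNorm ℤ) K ∧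
        ∃ (Dt : ModularParametrizationData W (W.conductorNorm ℤ)) (β : ℤ) (ι : K →+* ℂ) (d₁ : KolyvaginHeegnerData Dt β ι 1),
          Dt.c ≠ 0 ∧ ¬ IsOfFinAddOrder d₁.derivedPoint ∧
          (∃ M₀ : ℕ, padicValInt 2 Dt.c = M₀ ∧
            (∃ Q : (W.baseChange (ringClassField K ι 1)).toAffine.Point, ((2 ^ M₀ : ℕ) : ℤ) • Q = d₁.derivedPoint) ∧
            (¬ ∃ Q : (W.baseChange (ringClassField K ι 1)).toAffine.Point, ((2 ^ (M₀ + 1) : ℕ) : ℤ) • Q = d₁.derivedPoint)) ∧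
          ∃ (Wd : WeierstrassCurve ℚ) (_ : Wd.IsElliptic) (_ : Wd.IsGloballyMinimal),
            (∃ C : VariableChange ℚ, C • W.quadraticTwist (NumberField.discr K : ℚ) = Wd) ∧ Nat.card (Wd.selmerGroup 2) = 1 ∧
            ((W.Δ < 0 ∧ padicValNat 2 Wd.tamagawaProduct ≤ 1) ∨ padicValNat 2 Wd.tamagawaProduct = 0)) :
    ∀ (W : WeierstrassCurve ℚ) [W.IsElliptic] [W.IsGloballyMinimal], ¬ W.HasCM → W.analyticRank = 1 →
      Nat.card (W.selmerGroup 2) = 2 → Odd W.tamagawaProduct → W.HasSurjectiveModNGaloisRep 2 → 0 < W.Δ → MeetsEgg W := by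
  intro W _ _ hcm hr hSel hT hsurj hΔ
  haveI : NeZero (W.conductorNorm ℤ) := ⟨(W.conductorNorm_pos_holds).ne'⟩
  obtain ⟨K, iF, iN, hK, hodd, -, hH, Dt, β, ι, d₁, -, -, -, Wd, iE, iM, ⟨Cd, hCd⟩, hSel1, hbudget⟩ := hS2e W hcm hr hSel hT
  have hrk : W.mordellWeilRank = 1 := by rw [(hGZK W (le_of_eq hr)).1, hr]
  have hC0 : padicValNat 2 W.tamagawaProduct = 0 :=
    padicValNat.eq_zero_of_not_dvd (Nat.two_dvd_ne_zero.mpr (Nat.odd_iff.mp hT))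
  have h0 : padicValNat 2 Wd.tamagawaProduct = 0 := by
    rcases hbudget with ⟨hneg, -⟩ | h0
    · exact absurd hΔ (not_lt.mpr hneg.le)
    · exact h0
  exact meetsEgg_of_silent_selmerTrivial_twin W hK hodd hH hΔ hsurj hrk hSel Cd hCd (by rw [h0, hC0]) hSel1

/-- **This seat's prime-frame S2″′ likewise forces the egg** (mod GZK).  With `hS2ep` = the binder of `Line25.hTw0_of_slicedWall_of_reversedSupply
ExponentPrime_of_facts` verbatim (`d_K = −ℓ` prime, cubic rootless mod `ℓ` — silent by `Silent.padicValNat_two_tamagawaProduct_twin_eq_of_discr_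
eq_neg_prime_of_noRoot`): every non-CM globally minimal `W` with `r_an = 1`, `#Sel₂ = 2`, `ρ̄_{W,2}` onto, `Δ_W > 0`, `ord₂ C(W) = 0`
meets the egg.  So S2″′ must be asked on `hTw0^{egg}` only — there its Selmer clause may be dropped (§3).  CONDITIONAL on the displayed
hypotheses; proves nothing about BSD; closes nothing.  [cite: Kramer1981, §2 Prop. 6] [cite: MazurRubin2010, Cor. 3.4 (i)]
[cite: Kolyvagin1989Izv, Thm. A] -/
theorem meetsEgg_of_reversedSupplyExponentPrime_of_facts (hGZK : rank_eq_analyticRank_of_analyticRank_le_one)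
    (hS2ep : ∀ (W : WeierstrassCurve ℚ) [W.IsElliptic] [W.IsGloballyMinimal] [NeZero (W.conductorNorm ℤ)],
      ¬ W.HasCM → W.analyticRank = 1 → Nat.card (W.selmerGroup 2) = 2 → 0 < W.Δ → padicValNat 2 W.tamagawaProduct = 0 →
      ∃ (K : Type) (_ : Field K) (_ : NumberField K),
        IsImaginaryQuadratic K ∧
        (∃ ℓ : ℕ, ℓ.Prime ∧ NumberField.discr K = -(ℓ : ℤ) ∧
          ∀ x : ZMod ℓ, 4 * x ^ 3 + ((integralModelInt W).b₂ : ZMod ℓ) * x ^ 2 +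
            2 * ((integralModelInt W).b₄ : ZMod ℓ) * x + ((integralModelInt W).b₆ : ZMod ℓ) ≠ 0) ∧
        Odd (NumberField.discr K) ∧ NumberField.discr K ≠ -3 ∧ SatisfiesHeegnerHypothesis (W.conductorNorm ℤ) K ∧
        ∃ (Dt : ModularParametrizationData W (W.conductorNorm ℤ)) (β : ℤ) (ι : K →+* ℂ) (d₁ : KolyvaginHeegnerData Dt β ι 1),
          Dt.c ≠ 0 ∧ ¬ IsOfFinAddOrder d₁.derivedPoint ∧
          (∃ Q : (W.baseChange (ringClassField K ι 1)).toAffine.Point,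
            ((2 ^ (padicValInt 2 Dt.c) : ℕ) : ℤ) • Q = d₁.derivedPoint) ∧
          (¬ ∃ Q : (W.baseChange (ringClassField K ι 1)).toAffine.Point,
            ((2 ^ (padicValInt 2 Dt.c + 1) : ℕ) : ℤ) • Q = d₁.derivedPoint) ∧
          ∃ (Wd : WeierstrassCurve ℚ) (_ : Wd.IsElliptic) (_ : Wd.IsGloballyMinimal),
            (∃ C : WeierstrassCurve.VariableChange ℚ, C • W.quadraticTwist (NumberField.discr K : ℚ) = Wd) ∧
            Nat.card (Wd.selmerGroup 2) = 1) :
    ∀ (W : WeierstrassCurve ℚ) [W.IsElliptic] [W.IsGloballyMinimal], ¬ W.HasCM → W.analyticRank = 1 →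
      Nat.card (W.selmerGroup 2) = 2 → W.HasSurjectiveModNGaloisRep 2 → 0 < W.Δ → padicValNat 2 W.tamagawaProduct = 0 →
      MeetsEgg W := by
  intro W _ _ hcm hr hSel hsurj hΔ hC0
  haveI : NeZero (W.conductorNorm ℤ) := ⟨(W.conductorNorm_pos_holds).ne'⟩
  obtain ⟨K, iF, iN, hK, ⟨ℓ, hℓ, hdℓ, hnoRoot⟩, hodd, -, hH, Dt, β, ι, d₁, -, -, -, -, Wd, iE, iM, ⟨Cd, hCd⟩, hSel1⟩ :=
    hS2ep W hcm hr hSel hΔ hC0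
  have hrk : W.mordellWeilRank = 1 := by rw [(hGZK W (le_of_eq hr)).1, hr]
  have hSil : padicValNat 2 Wd.tamagawaProduct = padicValNat 2 W.tamagawaProduct :=
    padicValNat_two_tamagawaProduct_twin_eq_of_discr_eq_neg_prime_of_noRoot W hK hodd hH hℓ hdℓ hnoRoot Cd hCd
  exact meetsEgg_of_silent_selmerTrivial_twin W hK hodd hH hΔ hsurj hrk hSel Cd hCd hSil hSel1

end Summit.BirchSwinnertonDyer.BirchSwinnertonDyer.Theorems.GenusExact.TwinSwap.Egg

end
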